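import Literature.AlgebraicGeometry.Motives.ProjectiveIncidence
import Literature.AlgebraicGeometry.Motives.FanoSchemeOfLinesPoints
import Literature.AlgebraicGeometry.Motives.FanoSchemeOfPlanes
import Literature.AlgebraicGeometry.Motives.VarietiesProperProofs
import HarnessLib

/-!
# The correspondence of meeting lines `{(ℓ, ℓ') : ℓ ∩ ℓ' ≠ ∅} ⊆ F₁(X) ×ₖ F₁(X)`

For a field `k`, `n : ℕ` and a set `S ⊆ k[x₀, …, xₙ]` of forms of positive degree (`X = V₊(S) ⊆ ℙⁿ_k`)
this file constructs the **incidence correspondence of lines**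

  `meetingLines n k S = ℳ = {(ℓ, ℓ') ∈ F₁(X) ×ₖ F₁(X) | ℓ ∩ ℓ' ≠ ∅}`

(pairs of lines of `X` which meet — including `ℓ = ℓ'`), as the incidence correspondence
(`Incidence.subscheme`, `Motives/ProjectiveIncidence`) in `F₁(X) ×ₖ F₁(X) ⊆ ℙ^{n²+2n} ×ₖ ℙ^{n²+2n}`
(Plücker × Plücker, then Segre) cut out scheme-theoretically by the **line–line incidence relations**

  `(p ∧ p')_{abcd} = p_{ab} p'_{cd} - p_{ac} p'_{bd} + p_{ad} p'_{bc} + p_{bc} p'_{ad} - p_{bd} p'_{ac} + p_{cd} p'_{ab}`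

(`FanoScheme.lineMeetRel`), LINEAR forms in the Segre coordinates `z_{((i,j),(l,m))} = p_{ij} p'_{lm}`:
for `p = u ∧ v`, `p' = u' ∧ v'` these are the `4 × 4` minors of the matrix with rows `u, v, u', v'`
(Laplace expansion along the first two rows, `FanoScheme.lineMeetPairing_eq_wedgeVec`), i.e. the
Plücker coordinates of `u ∧ v ∧ u' ∧ v'`, so they all vanish iff `u, v, u', v'` are linearly
dependent iff the planes `span(u, v)`, `span(u', v')` meet non-trivially iff the lines
`ℙ(span(u, v))`, `ℙ(span(u', v'))` have a common point (`FanoScheme.forall_lineMeetMinor_eq_zero_iff`;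
for `n = 3` the single relation `p ∧ p' = 0` is the polarisation of the Plücker quadric, the
classical condition for two lines in `ℙ³` to meet). With: the closed immersion
`MeetingLines.emb : ℳ ⟶ F₁(X) ×ₖ F₁(X)`, the two (proper) projections `MeetingLines.fst/snd`,
projectivity, and the `L`-points: **`([u ∧ v], [u' ∧ v']) ∈ ℳ(L)` iff
`span(u, v) ⊓ span(u', v') ≠ ⊥`** (`MeetingLines.pt_lift_mem_range_emb_iff`, `MeetingLines.point`,
`MeetingLines.exists_eq_point`), in particular the diagonal lies in `ℳ` (`MeetingLines.diagPoint`).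

This is the correspondence `I = {(ℓ, ℓ') : ℓ ∩ ℓ' ≠ ∅}` on Fano schemes of lines used to build
cycle-theoretic operators on `F₁(X)` (e.g. for cubic hypersurfaces), here as a closed subscheme so
that its cycle class and its action on Chow groups / cohomology can be formed with the tree's
`Motives/Correspondences`, `HodgeTheory/CorrespondenceAction`. Incidence correspondences as closed
subschemes of products cut out by bilinear equations in Plücker coordinates: Eisenbud–Harris,
*3264 and all that*, §3.2.3 (PDF p. 135, the minors "can be expressed … as bilinear functions in the
coordinates"), and the many incidence correspondences of Ch. 3 and Ch. 6 (e.g. §3.4.1, Exercise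
3.31; §6.7, Exercise 6.54).

## What is NOT here

* The scheme structure of `ℳ` away from / along the diagonal (it is the determinantal one and is
  singular along `ℓ = ℓ'`), its dimension, its cycle class in `F₁ × F₁`, the residual
  correspondence `ℳ - Δ`; relative versions (lines inside a fixed linear subspace `Λ`).

## References

* D. Eisenbud, J. Harris, *3264 and All That*, Cambridge (2016): §3.2.1–§3.2.3 (Plücker
  coordinates; incidence via minors, PDF pp. 131–135). [EisenbudHarris2016]
* R. Hartshorne, *Algebraic Geometry* (1977), II Ex. 5.11 (Segre embedding). [Hartshorne1977]
-/

noncomputable section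

open CategoryTheory AlgebraicGeometry Limits MonoidalCategory CartesianMonoidalCategory
  MvPolynomial TopologicalSpace

universe u

namespace Literature.AlgebraicGeometry.Motives

attribute [local instance] MvPolynomial.gradedAlgebra

/-! ## The line–line incidence relations `p ∧ p' = 0` -/

namespace FanoScheme

section Relations

variable (n : ℕ) (k : Type u) [CommRing k]

local notation "𝐍" => n * n + 2 * n

/-- The Segre coordinate `z_{((i,j),(l,m))} = p_{ij} p'_{lm}` of
`ℙ^{n²+2n} × ℙ^{n²+2n} ↪ ℙ^{(n²+2n)² + 2(n²+2n)}` (Plücker indices `FanoScheme.plIdx`, Segre index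
`segreIndexEquiv`), as a variable. [folklore] -/
abbrev plpl (i j l m : Fin (n + 1)) : MvPolynomial (Fin (𝐍 * 𝐍 + 𝐍 + 𝐍 + 1)) k :=
  X (segreIndexEquiv 𝐍 𝐍 (plIdx n (i, j), plIdx n (l, m)))

/-- The **line–line incidence relation**
`(p ∧ p')_{abcd} = p_{ab}p'_{cd} - p_{ac}p'_{bd} + p_{ad}p'_{bc} + p_{bc}p'_{ad} - p_{bd}p'_{ac} + p_{cd}p'_{ab}`
(indices `(a, b, c, d)`), a linear form in the Segre coordinates `z_{((i,j),(l,m))} = p_{ij} p'_{lm}`: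
for `p = u ∧ v`, `p' = u' ∧ v'` it is the `4 × 4` minor of the matrix with rows `u, v, u', v'` on
the columns `a, b, c, d` (`lineMeetPairing_eq_wedgeVec`), a Plücker coordinate of `u ∧ v ∧ u' ∧ v'`.
[cite: EisenbudHarris2016, §3.2.3] -/
def lineMeetRel (q : Fin (n + 1) × Fin (n + 1) × Fin (n + 1) × Fin (n + 1)) :
    MvPolynomial (Fin (𝐍 * 𝐍 + 𝐍 + 𝐍 + 1)) k :=
  plpl n k q.1 q.2.1 q.2.2.1 q.2.2.2 - plpl n k q.1 q.2.2.1 q.2.1 q.2.2.2 +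
    plpl n k q.1 q.2.2.2 q.2.1 q.2.2.1 + plpl n k q.2.1 q.2.2.1 q.1 q.2.2.2 -
    plpl n k q.2.1 q.2.2.2 q.1 q.2.2.1 + plpl n k q.2.2.1 q.2.2.2 q.1 q.2.1

/-- The set of all line–line incidence relations. [folklore] -/
def lineMeetRels : Set (MvPolynomial (Fin (𝐍 * 𝐍 + 𝐍 + 𝐍 + 1)) k) :=
  Set.range (lineMeetRel n k)

/-- The line–line incidence relations are linear forms. [folklore] -/
theorem isHomogeneous_lineMeetRel (q : Fin (n + 1) × Fin (n + 1) × Fin (n + 1) × Fin (n + 1)) :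
    (lineMeetRel n k q).IsHomogeneous 1 :=
  (((((isHomogeneous_X k _).sub (isHomogeneous_X k _)).add (isHomogeneous_X k _)).add
    (isHomogeneous_X k _)).sub (isHomogeneous_X k _)).add (isHomogeneous_X k _)

/-- The line–line incidence relations are forms of positive degree. [folklore] -/
theorem lineMeetRels_forms :
    ∀ g ∈ lineMeetRels n k, ∃ m, 0 < m ∧ g.IsHomogeneous m := by
  rintro _ ⟨q, rfl⟩
  exact ⟨1, one_pos, isHomogeneous_lineMeetRel n k q⟩

end Relations

/-! ### The relations at `(u ∧ v) ⊗ (u' ∧ v')`: the `4 × 4` minors of `(u; v; u'; v')` -/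

section Minors

variable {n : ℕ} {k : Type u} [Field k] {L : Type u} [Field L] [Algebra k L]

/-- The Segre coordinate `z_{((i,j),(l,m))}` evaluates at `p ⊗ p'` to `p_{ij} p'_{lm}`. [folklore] -/
@[simp]
theorem aeval_segreVec_plpl (p p' : Fin (n + 1) → Fin (n + 1) → L) (i j l m : Fin (n + 1)) :
    aeval (ProjectiveSpace.segreVec (vecOfMatrix p) (vecOfMatrix p')) (plpl n k i j l m) =
      p i j * p' l m := by
  rw [plpl, ProjectiveSpace.aeval_segreVec_X]
  simp [vecOfMatrix]

/-- **The incidence relation `(a, b, c, d)` at `p ⊗ p'` is the pairing `(p ∧ p')_{abcd}`.**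
[folklore] -/
theorem aeval_segreVec_lineMeetRel (p p' : Fin (n + 1) → Fin (n + 1) → L)
    (q : Fin (n + 1) × Fin (n + 1) × Fin (n + 1) × Fin (n + 1)) :
    aeval (ProjectiveSpace.segreVec (vecOfMatrix p) (vecOfMatrix p')) (lineMeetRel n k q) =
      p q.1 q.2.1 * p' q.2.2.1 q.2.2.2 - p q.1 q.2.2.1 * p' q.2.1 q.2.2.2 +
        p q.1 q.2.2.2 * p' q.2.1 q.2.2.1 + p q.2.1 q.2.2.1 * p' q.1 q.2.2.2 -
        p q.2.1 q.2.2.2 * p' q.1 q.2.2.1 + p q.2.2.1 q.2.2.2 * p' q.1 q.2.1 := by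
  simp only [lineMeetRel, map_add, map_sub, aeval_segreVec_plpl]

/-- **Laplace expansion along two rows**: the pairing `((u ∧ v) ∧ (u' ∧ v'))_{abcd}` is the
`4 × 4` minor `det(u; v; u'; v')_{abcd}`, i.e. the Plücker coordinate
`FanoPlanes.wedgeVec ![u, v, u', v'] ![a, b, c, d]` of `u ∧ v ∧ u' ∧ v'` (`Motives/FanoSchemeOfPlanes`).
[folklore] -/
theorem lineMeetPairing_eq_wedgeVec (u v u' v' : Fin (n + 1) → L) (a b c d : Fin (n + 1)) :
    wedge u v a b * wedge u' v' c d - wedge u v a c * wedge u' v' b d +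
        wedge u v a d * wedge u' v' b c + wedge u v b c * wedge u' v' a d -
        wedge u v b d * wedge u' v' a c + wedge u v c d * wedge u' v' a b =
      FanoPlanes.wedgeVec ![u, v, u', v'] ![a, b, c, d] := by
  rw [FanoPlanes.wedgeVec_apply, Matrix.det_succ_row_zero]
  simp [Fin.sum_univ_succ, Matrix.det_fin_three, Matrix.submatrix, wedge, Fin.succAbove]
  ring

/-- Every multi-index `I : Fin 4 → Fin (n + 1)` is `![I 0, I 1, I 2, I 3]`. [folklore] -/
theorem vec_eq_vecCons_four (I : Fin 4 → Fin (n + 1)) : I = ![I 0, I 1, I 2, I 3] := by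
  ext i
  fin_cases i <;> rfl

/-- **Two planes `span(u, v)`, `span(u', v')` of `Lⁿ⁺¹` meet non-trivially iff `u, v, u', v'` are
linearly dependent** (`dim(W + W') + dim(W ∩ W') = 4`). [folklore] -/
theorem not_linearIndependent_four_iff {u v u' v' : Fin (n + 1) → L}
    (huv : LinearIndependent L ![u, v]) (huv' : LinearIndependent L ![u', v']) :
    ¬ LinearIndependent L ![u, v, u', v'] ↔
      Submodule.span L {u, v} ⊓ Submodule.span L {u', v'} ≠ ⊥ := by
  have hW : Module.finrank L (Submodule.span L ({u, v} : Set (Fin (n + 1) → L))) = 2 :=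
    finrank_span_pair huv
  have hW' : Module.finrank L (Submodule.span L ({u', v'} : Set (Fin (n + 1) → L))) = 2 :=
    finrank_span_pair huv'
  have hrange : Set.range ![u, v, u', v'] = {u, v} ∪ {u', v'} := by
    ext x
    simp
    tauto
  have hsup : Submodule.span L (Set.range ![u, v, u', v']) =
      Submodule.span L {u, v} ⊔ Submodule.span L {u', v'} := by
    rw [hrange, Submodule.span_union]
  have hdim := Submodule.finrank_sup_add_finrank_inf_eq
    (Submodule.span L ({u, v} : Set (Fin (n + 1) → L))) (Submodule.span L {u', v'})
  rw [hW, hW'] at hdim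
  rw [linearIndependent_iff_card_eq_finrank_span, Fintype.card_fin, Set.finrank, hsup, ne_eq,
    ← Submodule.finrank_eq_zero]
  omega

/-- **`(u ∧ v) ∧ (u' ∧ v') = 0` iff the lines meet**: all pairings `((u ∧ v) ∧ (u' ∧ v'))_{abcd}`
vanish iff `span(u, v) ⊓ span(u', v') ≠ ⊥`, i.e. iff the lines `ℙ(span(u, v))`, `ℙ(span(u', v'))` of
`ℙⁿ_L` have a common point (`u, v` and `u', v'` linearly independent). [cite: EisenbudHarris2016, §3.2.3] -/
theorem forall_lineMeetMinor_eq_zero_iff {u v u' v' : Fin (n + 1) → L}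
    (huv : LinearIndependent L ![u, v]) (huv' : LinearIndependent L ![u', v']) :
    (∀ a b c d, wedge u v a b * wedge u' v' c d - wedge u v a c * wedge u' v' b d +
        wedge u v a d * wedge u' v' b c + wedge u v b c * wedge u' v' a d -
        wedge u v b d * wedge u' v' a c + wedge u v c d * wedge u' v' a b = 0) ↔
      Submodule.span L {u, v} ⊓ Submodule.span L {u', v'} ≠ ⊥ := by
  rw [← not_linearIndependent_four_iff huv huv', ← FanoPlanes.wedgeVec_ne_zero_iff, not_not]
  constructor
  · intro h
    funext I
    rw [vec_eq_vecCons_four I, Pi.zero_apply, ← lineMeetPairing_eq_wedgeVec]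
    exact h _ _ _ _
  · intro h a b c d
    rw [lineMeetPairing_eq_wedgeVec, h, Pi.zero_apply]

/-- Hence: all line–line incidence relations vanish at `(u ∧ v) ⊗ (u' ∧ v')` iff the lines meet.
[folklore] -/
theorem forall_aeval_lineMeetRels_eq_zero_iff {u v u' v' : Fin (n + 1) → L}
    (huv : LinearIndependent L ![u, v]) (huv' : LinearIndependent L ![u', v']) :
    (∀ g ∈ lineMeetRels n k,
        aeval (ProjectiveSpace.segreVec (vecOfMatrix (wedge u v)) (vecOfMatrix (wedge u' v'))) g =
          0) ↔
      Submodule.span L {u, v} ⊓ Submodule.span L {u', v'} ≠ ⊥ := by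
  rw [← forall_lineMeetMinor_eq_zero_iff huv huv']
  constructor
  · intro h a b c d
    have h' := h _ ⟨(a, b, c, d), rfl⟩
    rwa [aeval_segreVec_lineMeetRel] at h'
  · rintro h _ ⟨q, rfl⟩
    rw [aeval_segreVec_lineMeetRel]
    exact h q.1 q.2.1 q.2.2.1 q.2.2.2

/-- Non-trivial intersection of the planes means a common point of the lines: a vector `x ≠ 0`
lying in both. [folklore] -/
theorem span_inf_span_ne_bot_iff (u v u' v' : Fin (n + 1) → L) :
    Submodule.span L {u, v} ⊓ Submodule.span L {u', v'} ≠ ⊥ ↔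
      ∃ x : Fin (n + 1) → L, x ≠ 0 ∧ x ∈ Submodule.span L {u, v} ∧
        x ∈ Submodule.span L {u', v'} := by
  rw [Submodule.ne_bot_iff]
  constructor
  · rintro ⟨x, hx, hx0⟩
    exact ⟨x, hx0, (Submodule.mem_inf.mp hx).1, (Submodule.mem_inf.mp hx).2⟩
  · rintro ⟨x, hx0, h₁, h₂⟩
    exact ⟨x, Submodule.mem_inf.mpr ⟨h₁, h₂⟩, hx0⟩

end Minors

end FanoScheme

/-! ## The correspondence of meeting lines as a `k`-scheme -/

section Scheme

open FanoScheme

variable (n : ℕ) (k : Type u) [Field k] (S : Set (MvPolynomial (Fin (n + 1)) k))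

/-- **The correspondence of meeting lines `ℳ = {(ℓ, ℓ') ∈ F₁(X) ×ₖ F₁(X) | ℓ ∩ ℓ' ≠ ∅}`** of
`X = V₊(S) ⊆ ℙⁿ_k`: the incidence correspondence in `F₁(X) ×ₖ F₁(X)` (Plücker × Plücker, then
Segre) cut out scheme-theoretically by the line–line incidence relations `(p ∧ p')_{abcd}` — the
`4 × 4` minors of `(u; v; u'; v')`, bilinear in the two sets of Plücker coordinates (Eisenbud–Harris,
*3264 and all that*, §3.2.3, PDF p. 135, for incidence conditions as bilinear functions of Plücker
coordinates). It contains the diagonal; its `L`-points are the pairs `([u ∧ v], [u' ∧ v'])` of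
lines on `X_L` with a common point (`MeetingLines.exists_eq_point`). [cite: EisenbudHarris2016, §3.2.3] -/
def meetingLines : SchemeOver k :=
  Incidence.subscheme (fanoSchemeOfLinesι n k S) (fanoSchemeOfLinesι n k S) (lineMeetRels n k)

namespace MeetingLines

/-- The closed immersion `ℳ ⟶ F₁(X) ×ₖ F₁(X)`. [folklore] -/
def emb : meetingLines n k S ⟶ fanoSchemeOfLines n k S ⊗ fanoSchemeOfLines n k S :=
  Incidence.emb _ _ _

/-- `ℳ ⟶ F₁(X) ×ₖ F₁(X)` is a closed immersion. [folklore] -/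
instance isClosedImmersion_emb_left : IsClosedImmersion (emb n k S).left :=
  Incidence.isClosedImmersion_emb_left _ _ _

/-- The first projection `ℳ ⟶ F₁(X)`, `(ℓ, ℓ') ↦ ℓ`. [folklore] -/
def fst : meetingLines n k S ⟶ fanoSchemeOfLines n k S :=
  Incidence.fst _ _ _

/-- The second projection `ℳ ⟶ F₁(X)`, `(ℓ, ℓ') ↦ ℓ'`. [folklore] -/
def snd : meetingLines n k S ⟶ fanoSchemeOfLines n k S :=
  Incidence.snd _ _ _

/-- `fst = emb ≫ pr₁`. [folklore] -/
theorem emb_fst : emb n k S ≫ CartesianMonoidalCategory.fst _ _ = fst n k S := rfl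

/-- `snd = emb ≫ pr₂`. [folklore] -/
theorem emb_snd : emb n k S ≫ CartesianMonoidalCategory.snd _ _ = snd n k S := rfl

/-- **The underlying set of `ℳ`**: a point of `F₁(X) ×ₖ F₁(X)` lies on `ℳ` iff its image under
Plücker × Plücker × Segre lies on the zero locus of the line–line incidence relations. [folklore] -/
theorem range_emb : Set.range (emb n k S).left =
    (Incidence.toSegre (fanoSchemeOfLinesι n k S) (fanoSchemeOfLinesι n k S)).left ⁻¹'
      ProjectiveSpectrum.zeroLocus
        (MvPolynomial.homogeneousSubmodule
          (Fin ((n * n + 2 * n) * (n * n + 2 * n) + (n * n + 2 * n) + (n * n + 2 * n) + 1)) k)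
        (lineMeetRels n k) :=
  Incidence.range_emb _ _ _

/-- `ℳ` is projective over `k`. [folklore] -/
theorem isProjectiveOver : IsProjectiveOver (meetingLines n k S) :=
  Incidence.isProjectiveOver _ _ _

/-- The first projection `ℳ ⟶ F₁(X)` is proper. [folklore] -/
instance isProper_fst_left : IsProper (fst n k S).left :=
  haveI := (isProjectiveOver_fanoSchemeOfLines n k S).isProper
  Incidence.isProper_fst_left _ _ _

/-- The second projection `ℳ ⟶ F₁(X)` is proper. [folklore] -/
instance isProper_snd_left : IsProper (snd n k S).left :=
  haveI := (isProjectiveOver_fanoSchemeOfLines n k S).isProper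
  Incidence.isProper_snd_left _ _ _

/-! ### `L`-points: `([u ∧ v], [u' ∧ v']) ∈ ℳ(L)` iff the lines meet -/

section Points

variable {n k S} {L : Type u} [Field L] [Algebra k L]

/-- **Membership criterion**: for lines `[u ∧ v], [u' ∧ v'] ∈ F₁(X)(L)`, the pair lies on `ℳ` iff
`span(u, v) ⊓ span(u', v') ≠ ⊥`, i.e. iff the two lines of `ℙⁿ_L` have a common point.
[cite: EisenbudHarris2016, §3.2.3] -/
theorem pt_lift_mem_range_emb_iff (hS : ∀ g ∈ S, ∃ m, 0 < m ∧ g.IsHomogeneous m)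
    (u v : Fin (n + 1) → L) (huv : LinearIndependent L ![u, v])
    (hg : ∀ g ∈ S, lineRestrict u v g = 0) (u' v' : Fin (n + 1) → L)
    (huv' : LinearIndependent L ![u', v']) (hg' : ∀ g ∈ S, lineRestrict u' v' g = 0) :
    AlgPoints.pt (lift (linePoint hS u v huv hg) (linePoint hS u' v' huv' hg')) ∈
        Set.range (emb n k S).left ↔
      Submodule.span L {u, v} ⊓ Submodule.span L {u', v'} ≠ ⊥ := by
  rw [← forall_aeval_lineMeetRels_eq_zero_iff (k := k) huv huv']
  exact Incidence.pt_lift_mem_range_emb_iff _ _ (lineMeetRels_forms n k) _ _ _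
    (map_linePoint hS u v huv hg) _ _ _ (map_linePoint hS u' v' huv' hg')

/-- **The `L`-point `([u ∧ v], [u' ∧ v'])` of `ℳ`**, for two lines on `X_L` with a common point.
[cite: EisenbudHarris2016, §3.2.3] -/
def point (hS : ∀ g ∈ S, ∃ m, 0 < m ∧ g.IsHomogeneous m)
    (u v : Fin (n + 1) → L) (huv : LinearIndependent L ![u, v])
    (hg : ∀ g ∈ S, lineRestrict u v g = 0) (u' v' : Fin (n + 1) → L)
    (huv' : LinearIndependent L ![u', v']) (hg' : ∀ g ∈ S, lineRestrict u' v' g = 0)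
    (hmeet : Submodule.span L {u, v} ⊓ Submodule.span L {u', v'} ≠ ⊥) :
    AlgPoints (meetingLines n k S) L :=
  Incidence.point _ _ (lineMeetRels_forms n k) _ _ _ (map_linePoint hS u v huv hg) _ _ _
    (map_linePoint hS u' v' huv' hg') ((forall_aeval_lineMeetRels_eq_zero_iff huv huv').mpr hmeet)

/-- `([u ∧ v], [u' ∧ v']) ↦ ([u ∧ v], [u' ∧ v'])` under `ℳ ⟶ F₁(X) ×ₖ F₁(X)`. [folklore] -/
@[simp]
theorem map_emb_point (hS : ∀ g ∈ S, ∃ m, 0 < m ∧ g.IsHomogeneous m)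
    (u v : Fin (n + 1) → L) (huv : LinearIndependent L ![u, v])
    (hg : ∀ g ∈ S, lineRestrict u v g = 0) (u' v' : Fin (n + 1) → L)
    (huv' : LinearIndependent L ![u', v']) (hg' : ∀ g ∈ S, lineRestrict u' v' g = 0)
    (hmeet : Submodule.span L {u, v} ⊓ Submodule.span L {u', v'} ≠ ⊥) :
    AlgPoints.map (emb n k S) (point hS u v huv hg u' v' huv' hg' hmeet) =
      lift (linePoint hS u v huv hg) (linePoint hS u' v' huv' hg') :=
  Incidence.map_emb_point _ _ _ _ _ _ _ _ _ _ _ _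

/-- `fst ([u ∧ v], [u' ∧ v']) = [u ∧ v]`. [folklore] -/
@[simp]
theorem map_fst_point (hS : ∀ g ∈ S, ∃ m, 0 < m ∧ g.IsHomogeneous m)
    (u v : Fin (n + 1) → L) (huv : LinearIndependent L ![u, v])
    (hg : ∀ g ∈ S, lineRestrict u v g = 0) (u' v' : Fin (n + 1) → L)
    (huv' : LinearIndependent L ![u', v']) (hg' : ∀ g ∈ S, lineRestrict u' v' g = 0)
    (hmeet : Submodule.span L {u, v} ⊓ Submodule.span L {u', v'} ≠ ⊥) :
    AlgPoints.map (fst n k S) (point hS u v huv hg u' v' huv' hg' hmeet) = linePoint hS u v huv hg :=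
  Incidence.map_fst_point _ _ _ _ _ _ _ _ _ _ _ _

/-- `snd ([u ∧ v], [u' ∧ v']) = [u' ∧ v']`. [folklore] -/
@[simp]
theorem map_snd_point (hS : ∀ g ∈ S, ∃ m, 0 < m ∧ g.IsHomogeneous m)
    (u v : Fin (n + 1) → L) (huv : LinearIndependent L ![u, v])
    (hg : ∀ g ∈ S, lineRestrict u v g = 0) (u' v' : Fin (n + 1) → L)
    (huv' : LinearIndependent L ![u', v']) (hg' : ∀ g ∈ S, lineRestrict u' v' g = 0)
    (hmeet : Submodule.span L {u, v} ⊓ Submodule.span L {u', v'} ≠ ⊥) :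
    AlgPoints.map (snd n k S) (point hS u v huv hg u' v' huv' hg' hmeet) =
      linePoint hS u' v' huv' hg' :=
  Incidence.map_snd_point _ _ _ _ _ _ _ _ _ _ _ _

/-- **Every `L`-point of `ℳ` is a pair `([u ∧ v], [u' ∧ v'])` of meeting lines on `X_L`.**
[cite: EisenbudHarris2016, §3.2.3] -/
theorem exists_eq_point (hS : ∀ g ∈ S, ∃ m, 0 < m ∧ g.IsHomogeneous m)
    (Q : AlgPoints (meetingLines n k S) L) :
    ∃ (u v : Fin (n + 1) → L) (huv : LinearIndependent L ![u, v])
      (hg : ∀ g ∈ S, lineRestrict u v g = 0) (u' v' : Fin (n + 1) → L)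
      (huv' : LinearIndependent L ![u', v']) (hg' : ∀ g ∈ S, lineRestrict u' v' g = 0)
      (hmeet : Submodule.span L {u, v} ⊓ Submodule.span L {u', v'} ≠ ⊥),
      Q = point hS u v huv hg u' v' huv' hg' hmeet := by
  set P := AlgPoints.map (emb n k S) Q with hPdef
  obtain ⟨u, v, huv, hg, h₁⟩ :=
    exists_eq_linePoint hS (AlgPoints.map (CartesianMonoidalCategory.fst _ _) P)
  obtain ⟨u', v', huv', hg', h₂⟩ :=
    exists_eq_linePoint hS (AlgPoints.map (CartesianMonoidalCategory.snd _ _) P)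
  have hP : P = lift (linePoint hS u v huv hg) (linePoint hS u' v' huv' hg') := by
    rw [← h₁, ← h₂]
    exact (AlgPoints.prodEquiv.symm_apply_apply P).symm
  have hmem : AlgPoints.pt (lift (linePoint hS u v huv hg) (linePoint hS u' v' huv' hg')) ∈
      Set.range (emb n k S).left := by
    rw [← hP]
    exact AlgPoints.pt_map_mem_range _ Q
  refine ⟨u, v, huv, hg, u', v', huv', hg',
    (pt_lift_mem_range_emb_iff hS u v huv hg u' v' huv' hg').mp hmem, ?_⟩
  apply AlgPoints.map_injective_of_mono (emb n k S)
  rw [map_emb_point, ← hP]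

/-- **The diagonal lies in `ℳ`**: the `L`-point `([u ∧ v], [u ∧ v])`. [folklore] -/
def diagPoint (hS : ∀ g ∈ S, ∃ m, 0 < m ∧ g.IsHomogeneous m)
    (u v : Fin (n + 1) → L) (huv : LinearIndependent L ![u, v])
    (hg : ∀ g ∈ S, lineRestrict u v g = 0) : AlgPoints (meetingLines n k S) L :=
  point hS u v huv hg u v huv hg (by
    rw [inf_idem, ne_eq, Submodule.span_eq_bot]
    intro h
    exact (LinearIndependent.ne_zero 0 huv) (h u (Set.mem_insert _ _)))

/-- The diagonal point maps to `([u ∧ v], [u ∧ v])`. [folklore] -/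
@[simp]
theorem map_emb_diagPoint (hS : ∀ g ∈ S, ∃ m, 0 < m ∧ g.IsHomogeneous m)
    (u v : Fin (n + 1) → L) (huv : LinearIndependent L ![u, v])
    (hg : ∀ g ∈ S, lineRestrict u v g = 0) :
    AlgPoints.map (emb n k S) (diagPoint hS u v huv hg) =
      lift (linePoint hS u v huv hg) (linePoint hS u v huv hg) :=
  map_emb_point _ _ _ _ _ _ _ _ _ _

/-- **Symmetry on points**: `([u ∧ v], [u' ∧ v']) ∈ ℳ(L)` iff `([u' ∧ v'], [u ∧ v]) ∈ ℳ(L)`.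
[folklore] -/
theorem pt_lift_mem_range_emb_comm (hS : ∀ g ∈ S, ∃ m, 0 < m ∧ g.IsHomogeneous m)
    (u v : Fin (n + 1) → L) (huv : LinearIndependent L ![u, v])
    (hg : ∀ g ∈ S, lineRestrict u v g = 0) (u' v' : Fin (n + 1) → L)
    (huv' : LinearIndependent L ![u', v']) (hg' : ∀ g ∈ S, lineRestrict u' v' g = 0) :
    AlgPoints.pt (lift (linePoint hS u v huv hg) (linePoint hS u' v' huv' hg')) ∈
        Set.range (emb n k S).left ↔
      AlgPoints.pt (lift (linePoint hS u' v' huv' hg') (linePoint hS u v huv hg)) ∈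
        Set.range (emb n k S).left := by
  rw [pt_lift_mem_range_emb_iff, pt_lift_mem_range_emb_iff, inf_comm]

end Points

end MeetingLines

end Scheme

end Literature.AlgebraicGeometry.Motives
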